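import Literature.MathematicalPhysics.QuantumFieldTheory.Balaban1983to89.B9Eq324DeltaPrimeATower
import Literature.MathematicalPhysics.QuantumFieldTheory.Balaban1983to89.B9Eq3119DeltaPiReality

/-!
# `Balaban1983to89.B9Eq326OperatorTowerReality` — T. Bałaban, *Propagators for lattice gauge theories in a background field*, Commun. Math. Phys. **99**
# (1985) 389–434 [Balaban1985BackgroundPropagators] p. 392 «For U with values in the unitary group U(N) it is a hermitian operator», (3.19) p. 393 (the
# composite `Q′_k = Q′(Ū^{k−1})⋯Q′(U)`), (3.21)–(3.25) p. 394: **THE `k`-TH-STEP LETTERS `Q′_k(U)`, `R_k(U)`, `Δ′_{a′,k}(U)`, `G′_k(U)` ARE REAL (commute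
# with `A ↦ A*`) AT A UNITARY TOWER** — the `k`-level twins of `B9Eq3119DeltaPiReality` §2 (ne9-leaf-02 gen 53, one step), stated for
# `B9Eq326OperatorTower.QprimeTowerW ∕ RofUk` and `B9Eq324DeltaPrimeATower.laplacePrimeAk ∕ GpOfUk`; the input for the `k`-level reality of print's
# `π_k(U)` and the identification of the bilinear and the adjoint `Δ_{π,k}` slots (sequel, on `B9Eq3119DeltaPiTower`)

statement-level skeleton of published theorems with citation tags; proofs where landed; nothing here is a claim about the Yang–Mills mass gap

CITATION HEADER (lean-in-tree rule).  Audit cell `pub-balaban`, sub-cell `t4`, BINDER row NE9; filed by NE9 formalisation-swarm leaf prover 05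
(`b2b-balaban-t4-ne9-formalise-leaf-05`, gen 75) for the OWNER t4-ne9-p1 g87's «Δ_π PORT» (DIAGNOSIS D-ne9p1-g87-1, journal 2026-08-23 l.51114; step (vi)
«the k-level reality», t4-ne9-idea-1 g99 W-2 l.51215 J-Δπ-hol: «the identification of the two slots at the unitary centre — ONCE per chart»).  CREDIT: every
proof idea is ne9-leaf-02 gen 53's (`B9Eq3119DeltaPiReality`), whose §1 generic reality calculus (`real_comp`, `real_adjoint`, `real_greenK`,
`real_starProjection`, …) and §2 one-step letters (`covDerivL2K_starW`, `covLaplaceSiteK_starW`, `pathTr_sW`, …) are used BY NAME on the tower lattice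
`towerP L m (n+1) = fineP L (towerP L m n)` (`B9Eq315QTower.towerP_succ`, `rfl`).  Source READ in the held text (`paper:balaban1985-cmp99-background-propagators`):
p. 392 l. «hermitian operator»; p. 393 (3.19) *«Q′_k = Q′(Ū^{k−1})⋯Q′(U)»*; p. 394 (3.21) *«R … the orthogonal projection onto ℛ = Δ^η_U N(Q′)»*, (3.24)–(3.25).
WHAT IS PROVED (sorry-free; proof lane — no `def`; [folklore] `*`-algebra bookkeeping; nothing of [B9] asserted).  Letters: a tower background
`U : Bond(T_{L^{n+1}m}) → 𝔸ˣ` whose LEVEL backgrounds `Ū^j = UlevOf L m (n+1) U j` are unitary (`hUlev`; displayed — for a `C⋆`-algebra the unitary group is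
averaging-closed, `B7Prop2Explicit.AvgClosed`, and `B7Eq43AveragedSmallnessLevelFree.UlevOf_mem` discharges it inside the small-field class), `U` itself unitary
(`hU`) where `D_U`, `D*_U`, `R(U(b))` enter, and the `*`-trace letters `hφ hτ₁ hτ₂` where an adjoint or a projection enters.
§1 `QprimeLin_sW` (ONE factor `Q′(V)` on plain site functions, any fine torus, unitary `V`), **`QprimeTower_sW`** (induction over the levels),
**`QprimeTowerW_starW`**, `QprimeTowerW_starW_eq_zero` (`N(Q′_k(U))` is `⋆`-invariant); §2 **`RofUk_starW`** (`real_starProjection` on `Δ_U N(Q′_k(U))`),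
`QtildeTowerW_starW`, **`laplacePrimeAk_starW`**, **`GpOfUk_starW`** (`real_greenK`).
HONEST SCOPE.  Reality letters only; `π_k`, `Δ_{π,k}`, `Δ̃_{a,k}` (the OWNER's `B9Eq3119DeltaPiTower`, definition lane) are the sequel's; NO estimate; NOT
NE9 (cell pub-balaban: NE9 NOT PRINTED ∕ NOT PROVED; «NE9 ⇐ the named binders»; spine PROVED 0∕9; rung (B)+1 on a finite T⁴ — NOT infinite volume, NOT mass
gap, NOT Clay; HONEST DEPENDENCY: continuum YM on T⁴ ⇐ BetaPertH ∧ nine spine estimates (0/9 proved); BetaPertH ⇐ (D1) ∧ (D4) ∧ CAP+tail; G-an2-4 gates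
asym, D1 and NE2/3/4).  NEW file importing `B9Eq324DeltaPrimeATower` + `B9Eq3119DeltaPiReality`; nothing modified.  Net new unproved facts: 0.
-/

noncomputable section

open scoped InnerProductSpace ComplexConjugate BigOperators

namespace Literature.MathematicalPhysics.QuantumFieldTheory.Balaban1983to89.B9Eq326OperatorTowerReality

open B4Sect5Torus (TSite)
open B9SectCLatticeCarrier (Bond)
open B9Eq311L2Pairing (WL2)
open B9Eq311TracePairing (starW starW_zero)
open B9Eq319QprimeTorus (fineP stepTransport QprimeLin)
open B9Eq323Ker (pathTr)
open B11Eq103H1Complex (SiteL2K BondL2K covLaplaceSiteK projR RLatticeK greenK)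
open B9Eq310HessianOperator (adTransportW)
open B9Eq315QTower (towerP UlevOf QprimeTower QprimeTower_succ)
open B9Eq326OperatorTower (QprimeTowerW RofUk)
open B9Eq324DeltaPrimeATower (laplacePrimeAk GpOfUk)
open B9Eq3119DeltaPiReality (sW_sum sW_real_smul sW_zero equiv_starW' pathTr_sW covLaplaceSiteK_starW real_starProjection real_add real_comp
  real_smul_ofReal real_adjoint real_greenK)

section Generic

variable {d : ℕ} (L : ℕ) [NeZero L] {𝔸 : Type*} [Ring 𝔸] [StarRing 𝔸] [Algebra ℂ 𝔸] [StarModule ℂ 𝔸]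
  {W : Type*} [NormedAddCommGroup W] [InnerProductSpace ℂ W] (φ : W ≃ₗ[ℂ] 𝔸)

/-! ## §1 The composite averaging `Q′_k(U)` is real at a unitary tower -/

/-- **ONE factor on plain site functions**: for a unitary `V` on the bonds of ANY fine torus `T_{L·m′}`, `Q′(V)(x ↦ l(x)⋆)(y) = ((Q′(V)l)(y))⋆` —
ne9-leaf-02's `QprimeW_starW` without the `L²` wrapper (`pathTr_sW` along the contours; real block weights). [cite: Balaban1985BackgroundPropagators, (3.19) p.393] -/
theorem QprimeLin_sW (m' : Fin d → ℕ) {V : Bond d (fineP L m') → 𝔸ˣ} (hV : ∀ b, star (V b : 𝔸) = ((V b)⁻¹ : 𝔸ˣ)) (l : TSite d (fineP L m') → W)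
    (y : TSite d m') :
    QprimeLin L m' (adTransportW φ V) (fun x => φ.symm (star (φ (l x)))) y = φ.symm (star (φ (QprimeLin L m' (adTransportW φ V) l y))) := by
  rw [B9Eq319QprimeTorus.QprimeLin_apply, B9Eq319QprimeTorus.QprimeLin_apply, B9Eq319QprimeTorus.Qprime, B9Eq319QprimeTorus.Qprime,
    B9Eq323Ker.avgQ, B9Eq323Ker.avgQ, sW_sum]
  refine Finset.sum_congr rfl fun x _ => ?_
  rw [sW_real_smul, ← pathTr_sW L m' φ hV]

/-- **THE COMPOSITE `Q′_k` IS REAL**: for level backgrounds `V_j` on `T_{L^{j+1}m}`, all unitary, `Q′_n(x ↦ l(x)⋆) = (y ↦ (Q′_n l)(y)⋆)` — induction on the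
number of levels (`QprimeTower_succ`: finest factor first). [cite: Balaban1985BackgroundPropagators, (3.19) p.393] -/
theorem QprimeTower_sW (m : Fin d → ℕ) (Vlev : (j : ℕ) → Bond d (towerP L m (j + 1)) → 𝔸ˣ)
    (hV : ∀ j b, star (Vlev j b : 𝔸) = ((Vlev j b)⁻¹ : 𝔸ˣ)) :
    ∀ (n : ℕ) (l : TSite d (towerP L m n) → W),
      QprimeTower L m (fun j => adTransportW φ (Vlev j)) n (fun x => φ.symm (star (φ (l x)))) =
        fun y => φ.symm (star (φ (QprimeTower L m (fun j => adTransportW φ (Vlev j)) n l y)))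
  | 0, l => rfl
  | n + 1, l => by
    have h1 : QprimeLin L (towerP L m n) (adTransportW φ (Vlev n)) (fun x => φ.symm (star (φ (l x)))) =
        fun x => φ.symm (star (φ (QprimeLin L (towerP L m n) (adTransportW φ (Vlev n)) l x))) :=
      funext fun x => QprimeLin_sW L φ (towerP L m n) (hV n) l x
    have ih := QprimeTower_sW m Vlev hV n (QprimeLin L (towerP L m n) (adTransportW φ (Vlev n)) l)
    have e1 : QprimeTower L m (fun j => adTransportW φ (Vlev j)) (n + 1) (fun x => φ.symm (star (φ (l x)))) =
        QprimeTower L m (fun j => adTransportW φ (Vlev j)) n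
          (QprimeLin L (towerP L m n) (adTransportW φ (Vlev n)) (fun x => φ.symm (star (φ (l x))))) := rfl
    have e2 : QprimeTower L m (fun j => adTransportW φ (Vlev j)) (n + 1) l =
        QprimeTower L m (fun j => adTransportW φ (Vlev j)) n (QprimeLin L (towerP L m n) (adTransportW φ (Vlev n)) l) := rfl
    rw [e1, e2, h1, ih]

end Generic

section Tower

variable {d : ℕ} (L : ℕ) [NeZero L] {𝔸 : Type*} [NormedRing 𝔸] [NormedAlgebra ℂ 𝔸] [CompleteSpace 𝔸] [StarRing 𝔸] [StarModule ℂ 𝔸]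
  {W : Type*} [NormedAddCommGroup W] [InnerProductSpace ℂ W] (φ : W ≃ₗ[ℂ] 𝔸)
  (m : Fin d → ℕ) [∀ i, NeZero (m i)] (n : ℕ) {c₀ : ℝ} [Fact (0 < c₀)] (η : ℝ) {U : Bond d (towerP L m (n + 1)) → 𝔸ˣ}
  (hUlev : ∀ (j : ℕ) (b : Bond d (towerP L m (j + 1))), star (UlevOf L m (n + 1) U j b : 𝔸) = ((UlevOf L m (n + 1) U j b)⁻¹ : 𝔸ˣ))

include hUlev in
omit [Fact (0 < c₀)] in
/-- **`Q′_k(U)` ON THE `L²` CARRIER IS REAL**: `Q′_k(U)(f⋆)(y) = ((Q′_k(U)f)(y))⋆` for a tower whose level backgrounds `Ū^j` are unitary.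
[cite: Balaban1985BackgroundPropagators, (3.19) p.393] -/
theorem QprimeTowerW_starW (f : SiteL2K ℂ d (towerP L m (n + 1)) c₀ W) (y : TSite d m) :
    QprimeTowerW L m n φ U (starW φ f) y = φ.symm (star (φ (QprimeTowerW L m n φ U f y))) := by
  unfold QprimeTowerW
  rw [LinearMap.comp_apply, LinearMap.comp_apply]
  have h := congrFun (QprimeTower_sW L φ m (fun j => UlevOf L m (n + 1) U j) hUlev (n + 1)
    ((WL2.linearEquiv ℂ ℂ (fun _ : TSite d (towerP L m (n + 1)) => c₀)).toLinearMap f)) y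
  exact h

include hUlev in
omit [Fact (0 < c₀)] in
/-- `N(Q′_k(U))` is `⋆`-invariant. [cite: Balaban1985BackgroundPropagators, (3.21) p.394] -/
theorem QprimeTowerW_starW_eq_zero {f : SiteL2K ℂ d (towerP L m (n + 1)) c₀ W} (hf : QprimeTowerW L m n φ U f = 0) :
    QprimeTowerW L m n φ U (starW φ f) = 0 := by
  funext y
  rw [QprimeTowerW_starW L φ m n hUlev, hf, Pi.zero_apply, sW_zero]

/-! ## §2 `R_k(U)`, `Δ′_{a′,k}(U)`, `G′_k(U)` are real -/

variable (hU : ∀ b, star (U b : 𝔸) = ((U b)⁻¹ : 𝔸ˣ)) [FiniteDimensional ℂ W] (τ : 𝔸 →ₗ[ℂ] ℂ)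
  (hφ : ∀ X Y : 𝔸, ⟪φ.symm X, φ.symm Y⟫_ℂ = τ (star X * Y)) (hτ₁ : ∀ X : 𝔸, τ (star X) = conj (τ X)) (hτ₂ : ∀ X Y : 𝔸, τ (X * Y) = τ (Y * X))

include hUlev hU hφ hτ₁ hτ₂ in
/-- **`R_k(U)` IS REAL** — the orthogonal projection (3.21) onto the `⋆`-invariant `Δ_U N(Q′_k(U))` (ne9-leaf-02's `real_starProjection`; `Δ_U` real by
`covLaplaceSiteK_starW` on the tower lattice). [cite: Balaban1985BackgroundPropagators, (3.21) p.394] -/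
theorem RofUk_starW (f : SiteL2K ℂ d (towerP L m (n + 1)) c₀ W) : RofUk L m n φ η U (starW φ f) = starW φ (RofUk L m n φ η U f) := by
  unfold RofUk RLatticeK projR
  simp only [ContinuousLinearMap.coe_coe]
  refine real_starProjection φ τ hφ hτ₁ hτ₂ _ (fun g hg => ?_) f
  obtain ⟨l, hl, rfl⟩ := Submodule.mem_map.1 hg
  refine Submodule.mem_map.2 ⟨starW φ l, ?_, covLaplaceSiteK_starW L (towerP L m n) φ η hU l⟩
  rw [LinearMap.mem_ker] at hl ⊢
  exact QprimeTowerW_starW_eq_zero L φ m n hUlev hl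

variable {c₁ : ℝ} [Fact (0 < c₁)] (a' : ℝ)

include hUlev in
omit [FiniteDimensional ℂ W] [Fact (0 < c₁)] [Fact (0 < c₀)] in
/-- `Q̃′_k(U)` (read into the `c₁`-weighted unit-lattice carrier, as in `laplacePrimeAk`) is real. [cite: Balaban1985BackgroundPropagators, (3.24) p.394] -/
theorem QtildeTowerW_starW (f : SiteL2K ℂ d (towerP L m (n + 1)) c₀ W) :
    ((WL2.linearEquiv ℂ ℂ (fun _ : TSite d m => c₁)).symm.toLinearMap ∘ₗ QprimeTowerW L m n φ U) (starW φ f) =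
      starW φ (((WL2.linearEquiv ℂ ℂ (fun _ : TSite d m => c₁)).symm.toLinearMap ∘ₗ QprimeTowerW L m n φ U) f) := by
  apply (WL2.equiv ℂ (fun _ : TSite d m => c₁) W).injective
  funext y
  rw [equiv_starW']
  simp only [LinearMap.comp_apply, LinearEquiv.coe_coe, WL2.linearEquiv_symm_apply, Equiv.apply_symm_apply]
  exact QprimeTowerW_starW L φ m n hUlev f y

include hUlev hU hφ hτ₁ hτ₂ in
/-- **`Δ′_{a′,k}(U) = Δ_U + a′Q̃′_k(U)†Q̃′_k(U)` IS REAL** (`a′` real; the adjoint of the real `Q̃′_k(U)` is real). [cite: Balaban1985BackgroundPropagators, (3.24) p.394] -/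
theorem laplacePrimeAk_starW (f : SiteL2K ℂ d (towerP L m (n + 1)) c₀ W) :
    laplacePrimeAk L m n φ η U a' (c₁ := c₁) (starW φ f) = starW φ (laplacePrimeAk L m n φ η U a' (c₁ := c₁) f) := by
  rw [laplacePrimeAk]
  refine real_add φ (covLaplaceSiteK_starW L (towerP L m n) φ η hU)
    (real_smul_ofReal φ (real_comp φ ?_ (QtildeTowerW_starW L φ m n hUlev)) a') f
  exact real_adjoint φ τ hφ hτ₁ hτ₂ (QtildeTowerW_starW L φ m n hUlev)

include hUlev hU hφ hτ₁ hτ₂ in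
/-- **`G′_k(U) = (Δ′_{a′,k}(U))⁻¹` IS REAL.** [cite: Balaban1985BackgroundPropagators, (3.25) p.394] -/
theorem GpOfUk_starW (hpos' : ∀ x : SiteL2K ℂ d (towerP L m (n + 1)) c₀ W, x ≠ 0 → 0 < RCLike.re ⟪x, laplacePrimeAk L m n φ η U a' (c₁ := c₁) x⟫_ℂ)
    (f : SiteL2K ℂ d (towerP L m (n + 1)) c₀ W) :
    GpOfUk L m n φ η U a' hpos' (starW φ f) = starW φ (GpOfUk L m n φ η U a' hpos' f) :=
  real_greenK φ hpos' (laplacePrimeAk_starW L φ m n η hUlev hU τ hφ hτ₁ hτ₂ a') f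

end Tower

end Literature.MathematicalPhysics.QuantumFieldTheory.Balaban1983to89.B9Eq326OperatorTowerReality

end
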